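import Mathlib
import Summits.QuantumFields.YangMills.Theorems.CoarseStiffnessTailCappedCoarseStiffnessLUnitCountLogSlack

/-!
# Route `CoarseStiffnessTail` — THE RATE-FREE TOP-SLICE SUPPLIER OF `HistoryTailL`: a POWER-LAW unit-scale large-field tail
# `P_top ≤ C·γ^s` with ANY exponent `s > 3`, uniform in the cut-off and the volume, already closes 19936 and 27959; the registered EDGE
# stub, its logarithmic form and the crux all imply it (lead's certificate, seat `ym-line-cst-p1` g22; helper on crux stmt-QuantumFields-25301)

Notation.  Run `K` of the family `F` (block size `L`, volume exponent `m`): finest lattice `2L^{m+K}` sites per direction, Wilson law `Gibbs_K`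
at `β_K = (γL^{-K})⁻¹`; `Ū^{K}` = the `K`-fold (0.4)-block-averaged field, a field on the UNIT lattice (`2L^m` sites per direction);
`p = B10.pFun b₀ p₀`, `θ_γ(h) = θBal L γ b₀ p₀ h = g_h·p(g_h)`, `g_h² = γL^{-h}`.  For a unit plaquette `a` write
`P_top(F, γ, K, a) := Gibbs_K{θ_γ(0) ≤ |Ū^{K}(∂a) − 1|}` — the probability that ONE plaquette of the fully averaged configuration is large
at Bałaban's unit-scale threshold.

THE STATEMENT RECORDED HERE (definition-free, written out in every theorem that uses it):

  S1_poly (UnitLargeFieldTailPoly) :=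
    `∀ L b₁ p₁ ∃ b₀ ≥ b₁, p₀ ≥ p₁ (0 < b₀, 2 < p₀) ∃ s > 3, C ≥ 0, γ₁ ∈ (0,1] ∀ F (F.L = L) ∀ γ ∈ (0, γ₁] ∀ K ∀ a ∈ Plaq_K :`
    `P_top(F, γ, K, a) ≤ C·γ^s`.

No Gaussian rate `e^{−c·p(g)²}`, no rate constant `c₀`, no joint event, no free energy: a POWER of the coupling with any exponent above the
dimension `d = 3`, a profile chosen by the prover beyond prescribed thresholds (as in 19936 itself), uniformity in `(K, m, γ ≤ γ₁)` only.

* §1 `real_plaqLarge_refine` — refinement transport of ONE plaquette's tail (g4/g20's level identification for a single event): the tail of a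
  height-`j` plaquette of run `j + d` of `F` at `γ` IS the top-slice tail of a unit plaquette of run `j` of `F.refine d` at `γL^{-d}`.
* §2 ★★ `averagedTailAt_of_polyTail` — for ONE admissible `(F, γ)`: the power-law tail along the refinement orbit `(F.refine d, γL^{-d})` gives the
  parent route's `AveragedTailAt F γ b₀ p₀` with the GEOMETRIC profile `q(i) = 72·C·L^{3m}·γ^s·(L³·L^{-s})^i` — at depth `i` there are
  `≤ 72·L^{3m}·L^{3i}` plaquettes, each with tail `≤ C·(γL^{-i})^s`; ratio `L^{3−s} < 1` exactly because `s > 3`.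
* §3 ★★★ `historyTailL_of_unitPolyTail` : S1_poly ⇒ `UnitScaleTilt.HistoryTailL` (stmt-QuantumFields-19936) BY NAME (`historyTailAt_of_averagedTailAt`;
  the bare height is the tree's landed `bareTailAt`); `wedgeTailL_of_unitPolyTail` : S1_poly ⇒ `HistoryWedge.WedgeTailL` (stmt-QuantumFields-27959) BY
  NAME with the floor rate `ρ = L^{-s}`, `ρL³ = L^{3−s} < 1` (the wedge guard is not even used).
* §4 `ym3TorusSU2_of_residuals_and_unitPolyTail` — the re-typed route's deciding theorem, kernel-checked: `UnitScaleTilt.closes` fed with the two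
  residual cruxes (19200, 20520) and with S1_poly in place of `HistoryTailL` concludes the rung-R3 leaf `YM3TorusSU2` (CONDITIONAL on three OPEN
  hypotheses; a RECORD rung, not Clay).
* Companion file `…LUnitPolyTailOfCount` (same seat): S1_log ⇒ S1_poly by the chessboard at the top slice and `e^{−c·p(√γ)²} ≤ γ^N`; hence the
  registered EDGE stub S1_top ⇒ S1_poly and the crux 25301 ⇒ S1_poly.

Kernel partial order recorded (this file and its companion; by name where items exist; nothing else is claimed):
  `CappedCoarseStiffnessL (25301) ⇒ S1_top ⇒ S1_log ⇒ S1_poly ⇒ {UnitScaleTilt.HistoryTailL (19936), HistoryWedge.WedgeTailL (27959)}`.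

READING (for planners / director / a siege; no claim about Bałaban's estimates).
(1) WHAT 19936 NEEDS FROM THE UNIT SCALE IS A POWER, NOT A GAUSSIAN.  The union bound over the `≍ L^{3(m+i)}` plaquettes at depth `i` and the sum
    over the free top fraction need the single-plaquette tail at unit coupling `γ'` to be `O(γ'^s)` for some `s > 3`, uniformly in cut-off and
    volume — nothing more.  Bałaban's factor `e^{−¼p(g)²}` ([Balaban1985UV3] (71) p.273; `p₀ > 2`) is smaller than every power; the typed EDGE stub
    S1_top asks in addition for a JOINT exponential moment at the Gaussian rate `c₀·p(g)²` with ONE `c₀` for all `γ ≤ γ₁` and EVERY profile.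
(2) WHY THE RATE FORMAT MATTERS FOR A SIEGE.  The owner's landed per-plaquette output of the (α)-record chain
    (`HistoryTailLaneTailIntRows.perPlaquetteHighL_of_intCoreRecRows`) has the exponent `−c·p(g)² + κ·(1 + log g⁻¹)^{2+3r₀}`: the collar volumes
    `R(g)³ = R₁³(1 + log g⁻¹)^{3r₀}` of the large-field regions ([Balaban1985UV3] (39) p.266) DEGRADE the rate, and the degradation is absorbed only
    because the profile exponent is chosen with `2p₀ > 2 + 3r₀` — i.e. for a profile fixed BEFOREHAND by the statement (S1_top: `∀ b₀ p₀`) and a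
    uniform `c₀`, a transcription of print is not expected to deliver the typed format, while it delivers `O(γ^s)` for every `s`.  S1_poly is the
    meet: implied by S1_top/S1_log (companion file) and of the shape such a chain produces once its constants are volume- and coupling-uniform.
(3) For the planners' re-type of 25301 (asked since g14): «25301 := S1_poly» — signature = the hypothesis `hP` of `historyTailL_of_unitPolyTail`
    verbatim; glue = that theorem (proved here); deciding theorem = §4.

HONEST SCOPE.  Transport, a union bound and a geometric series on top of landed certificates; NO
Gibbs integral is estimated; S1_poly, S1_log, S1_top, the crux 25301, `HistoryTailL` 19936, `WedgeTailL` 27959 and every rung above stay OPEN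
(their common content is ultraviolet stability of the unit-scale large-field probability, [Balaban1985UV3] (71) at the last renormalisation steps,
integrated against the Gibbs law, uniformly in the cut-off); `YM3TorusSU2` (rung R3, a RECORD rung, not the Clay statement) is NOT proved; the
Yang–Mills mass gap is NOT touched.

References: T. Bałaban, CMP **102** (1985) 255–275 [Balaban1985UV3] ((1)–(3) p.256, (7) p.257, (39) p.266, (71) p.273); C. King, CMP **103**
(1986) 323–349 [King1986] ((3.12) p.657: the free top fraction); J. Fröhlich, R. Israel, E. Lieb, B. Simon, CMP **62** (1978) 1–34
[FrohlichIsraelLiebSimon1978] (Thm 4.1: chessboard).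
-/

noncomputable section

namespace Summit.QuantumFields.YangMills.Theorems.CoarseStiffnessTailUnitPolyTail

open MeasureTheory Finset
open Literature.MathematicalPhysics.QuantumFieldTheory
open Literature.MathematicalPhysics.QuantumFieldTheory.Balaban1983to89
open Literature.MathematicalPhysics.QuantumFieldTheory.Balaban1983to89.T3ContinuumYM3Torus
open Literature.MathematicalPhysics.QuantumFieldTheory.Balaban1983to89.T3UnitScaleTilt
open Literature.MathematicalPhysics.QuantumFieldTheory.Balaban1983to89.T3UnitLawDensityEML
open Literature.MathematicalPhysics.QuantumFieldTheory.Balaban1983to89.T3LevelShift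
open Literature.MathematicalPhysics.QuantumFieldTheory.Balaban1983to89.T3ThresholdRemoval
open Literature.MathematicalPhysics.QuantumFieldTheory.Balaban1983to89.T3BareTailProfile
open Literature.MathematicalPhysics.QuantumFieldTheory.Balaban1983to89.T3CruxEstimates (real_not_plaqSmall_comp_le_sum)
open Summit.QuantumFields.YangMills.Theorems.LargeFieldMassRefinementTailSubGaussianRung (measurable_dist1_iter)
open Summit.QuantumFields.YangMills.Theorems.CoarseStiffnessTailHistoryTailOfStiffness (card_plaq_le_nine_mul)
open Summit.QuantumFields.YangMills.Theorems.CoarseStiffnessTailUnitSlice (θBal_eq_θBal_refine_zero)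
open Summit.QuantumFields.YangMills.Theorems.CoarseStiffnessTailUnitLatticeStubs (coupling_refine_pos_le)

/-! ## §1 Transport of ONE plaquette's tail along the refinement orbit -/

section Transport

variable (F : T3Family)

/-- ★ **THE TAIL OF A HEIGHT-`j` PLAQUETTE OF RUN `j + d` IS A TOP-SLICE TAIL OF RUN `j` OF `F.refine d`** (coupling `γL^{-d}`): same finest
lattice and Wilson weight (`T3ThresholdRemoval.integral_gibbsMeasure_comp_fieldShift`, `T3Family.refine_β`), block averagings matched level by level
(`T3LevelShift.iter_fieldShift`), the plaquette reindexed by `plaqShift` (`plaqHol_fieldShift`).  The single-event form of g4's/g20's transport.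
[cite: Balaban1985UV3, (1)-(3) p.256] -/
theorem real_plaqLarge_refine {γ : ℝ} (hγ : 0 ≤ γ) (θ : ℝ) (d j : ℕ) (a : Plaq (F.P (j + d)) j) :
    ∃ a' : Plaq ((F.refine d).P j) j,
      (T3UnitScaleTilt.gibbsK F T3UnitLawDensityEML.ℰp γ (j + d)).real
          {U | θ ≤ GaugeGroup.dist1 (GaugeField.plaqHol
            (Averaging.iter (fun i => BlockAveraging.blockAvg (P := F.P (j + d)) (j := i) T3UnitLawDensityEML.ℰp) j U) a)} =
        (T3UnitScaleTilt.gibbsK (F.refine d) T3UnitLawDensityEML.ℰp (γ * ((F.L : ℝ)⁻¹) ^ d) j).real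
          {V | θ ≤ GaugeGroup.dist1 (GaugeField.plaqHol
            (Averaging.iter (fun i => BlockAveraging.blockAvg (P := (F.refine d).P j) (j := i) T3UnitLawDensityEML.ℰp) j V) a')} := by
  have hmK : F.m + (j + d) = F.m + d + j := by omega
  have hj : (F.PP F.m (j + d)).sitesPerDir j = (F.PP (F.m + d) j).sitesPerDir j :=
    F.sitesPerDir_eq (m := F.m) (K := j + d) (j := j) (m' := F.m + d) (K' := j) (j' := j) (by omega)
  refine ⟨plaqShift hj a, ?_⟩
  have hβ : ((F.refine d).scheme ℰp (γ * ((F.L : ℝ)⁻¹) ^ d)).β j = (F.scheme ℰp γ).β (j + d) := F.refine_β ℰp γ d j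
  have hβ0 : 0 ≤ (F.scheme ℰp γ).β (j + d) := F.scheme_β_nonneg ℰp hγ (j + d)
  -- the two indicator functions, written as `if`s, correspond under the level identification
  set f : GaugeField (F.P (j + d)) 0 (Matrix.specialUnitaryGroup (Fin 2) ℂ) → ℝ := fun U =>
    if θ ≤ GaugeGroup.dist1 (GaugeField.plaqHol
      (Averaging.iter (fun i => BlockAveraging.blockAvg (P := F.P (j + d)) (j := i) T3UnitLawDensityEML.ℰp) j U) a)
    then 1 else 0 with hfdef
  set f' : GaugeField ((F.refine d).P j) 0 (Matrix.specialUnitaryGroup (Fin 2) ℂ) → ℝ := fun V =>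
    if θ ≤ GaugeGroup.dist1 (GaugeField.plaqHol
      (Averaging.iter (fun i => BlockAveraging.blockAvg (P := (F.refine d).P j) (j := i) T3UnitLawDensityEML.ℰp) j V)
        (plaqShift hj a)) then 1 else 0 with hf'def
  have hpt : ∀ V, f (fieldShift (sitesPerDir_refine_zero F d j) V) = f' V := by
    intro V
    have key := iter_fieldShift ℰp hmK j V
    simp only [hfdef, hf'def]
    erw [key, plaqHol_fieldShift]
    rfl
  have hmeas : MeasurableSet {U : GaugeField (F.P (j + d)) 0 (Matrix.specialUnitaryGroup (Fin 2) ℂ) |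
      θ ≤ GaugeGroup.dist1 (GaugeField.plaqHol
        (Averaging.iter (fun i => BlockAveraging.blockAvg (P := F.P (j + d)) (j := i) T3UnitLawDensityEML.ℰp) j U) a)} :=
    measurableSet_le measurable_const (measurable_dist1_iter F (j + d) j a)
  have hmeas' : MeasurableSet {V : GaugeField ((F.refine d).P j) 0 (Matrix.specialUnitaryGroup (Fin 2) ℂ) |
      θ ≤ GaugeGroup.dist1 (GaugeField.plaqHol
        (Averaging.iter (fun i => BlockAveraging.blockAvg (P := (F.refine d).P j) (j := i) T3UnitLawDensityEML.ℰp) j V)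
          (plaqShift hj a))} :=
    measurableSet_le measurable_const (measurable_dist1_iter (F.refine d) j j (plaqShift hj a))
  have hI : (T3UnitScaleTilt.gibbsK F T3UnitLawDensityEML.ℰp γ (j + d)).real
        {U | θ ≤ GaugeGroup.dist1 (GaugeField.plaqHol
          (Averaging.iter (fun i => BlockAveraging.blockAvg (P := F.P (j + d)) (j := i) T3UnitLawDensityEML.ℰp) j U) a)} =
      ∫ U, f U ∂(T3UnitScaleTilt.gibbsK F T3UnitLawDensityEML.ℰp γ (j + d)) := by
    rw [← integral_indicator_one hmeas]
    refine integral_congr_ae (Filter.Eventually.of_forall fun U => ?_)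
    simp only [hfdef, Set.indicator_apply, Set.mem_setOf_eq, Pi.one_apply]
  have hI' : (T3UnitScaleTilt.gibbsK (F.refine d) T3UnitLawDensityEML.ℰp (γ * ((F.L : ℝ)⁻¹) ^ d) j).real
        {V | θ ≤ GaugeGroup.dist1 (GaugeField.plaqHol
          (Averaging.iter (fun i => BlockAveraging.blockAvg (P := (F.refine d).P j) (j := i) T3UnitLawDensityEML.ℰp) j V)
            (plaqShift hj a))} =
      ∫ V, f' V ∂(T3UnitScaleTilt.gibbsK (F.refine d) T3UnitLawDensityEML.ℰp (γ * ((F.L : ℝ)⁻¹) ^ d) j) := by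
    rw [← integral_indicator_one hmeas']
    refine integral_congr_ae (Filter.Eventually.of_forall fun V => ?_)
    simp only [hf'def, Set.indicator_apply, Set.mem_setOf_eq, Pi.one_apply]
  rw [hI, hI', gibbsK_eq, gibbsK_eq, hβ]
  refine ((integral_gibbsMeasure_comp_fieldShift (G := Matrix.specialUnitaryGroup (Fin 2) ℂ)
    (sitesPerDir_refine_zero F d j) hβ0 f).symm).trans ?_
  exact integral_congr_ae (Filter.Eventually.of_forall hpt)

end Transport

/-! ## §2 One admissible `(F, γ)`: the power-law tail along the refinement orbit gives `AveragedTailAt` with a geometric profile -/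

section Averaged

variable (F : T3Family)

/-- The ratio of the geometric profile: `r = L³·(L⁻¹)^s` satisfies `0 ≤ r < 1` for `s > 3`, `L > 1` (`(L⁻¹)^s < (L⁻¹)^3`).
[folklore] -/
theorem ratio_lt_one {s : ℝ} (hs : 3 < s) :
    0 ≤ (F.L : ℝ) ^ 3 * ((F.L : ℝ)⁻¹) ^ s ∧ (F.L : ℝ) ^ 3 * ((F.L : ℝ)⁻¹) ^ s < 1 := by
  have hL1 : (1 : ℝ) < F.L := by exact_mod_cast F.hL.2
  have hL0 : (0 : ℝ) < F.L := one_pos.trans hL1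
  have hi0 : 0 < ((F.L : ℝ)⁻¹) := inv_pos.mpr hL0
  have hi1 : ((F.L : ℝ)⁻¹) < 1 := inv_lt_one_of_one_lt₀ hL1
  refine ⟨mul_nonneg (pow_nonneg hL0.le 3) (Real.rpow_nonneg hi0.le s), ?_⟩
  have hlt : ((F.L : ℝ)⁻¹) ^ s < ((F.L : ℝ)⁻¹) ^ ((3 : ℕ) : ℝ) :=
    Real.rpow_lt_rpow_of_exponent_gt hi0 hi1 (by exact_mod_cast hs)
  rw [Real.rpow_natCast, inv_pow] at hlt
  have h3 : (0 : ℝ) < (F.L : ℝ) ^ 3 := pow_pos hL0 3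
  calc (F.L : ℝ) ^ 3 * ((F.L : ℝ)⁻¹) ^ s < (F.L : ℝ) ^ 3 * ((F.L : ℝ) ^ 3)⁻¹ :=
        mul_lt_mul_of_pos_left hlt h3
    _ = 1 := mul_inv_cancel₀ h3.ne'

/-- The power of a refined coupling splits along the profile: `(γ·(L⁻¹)^i)^s = γ^s·((L⁻¹)^s)^i` (`γ ≥ 0`). [folklore] -/
theorem rpow_coupling_refine {γ : ℝ} (hγ : 0 ≤ γ) (s : ℝ) (i : ℕ) :
    (γ * ((F.L : ℝ)⁻¹) ^ i) ^ s = γ ^ s * (((F.L : ℝ)⁻¹) ^ s) ^ i := by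
  have hL0 : (0 : ℝ) ≤ ((F.L : ℝ)⁻¹) := inv_nonneg.mpr (Nat.cast_nonneg _)
  rw [Real.mul_rpow hγ (pow_nonneg hL0 i), ← Real.rpow_natCast_mul hL0, mul_comm (i : ℝ) s, Real.rpow_mul_natCast hL0]

/-- ★★ **ONE FAMILY, ONE COUPLING: A POWER-LAW TOP-SLICE TAIL ALONG THE REFINEMENT ORBIT GIVES `AveragedTailAt`** (`0 < γ`, `s > 3`, `C ≥ 0`):
if every unit plaquette of every run `K'` of every refined family `F.refine d` at coupling `γL^{-d}` has tail `≤ C·(γL^{-d})^s` at its own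
threshold `θ_{γL^{-d}}(0)`, then `AveragedTailAt F γ b₀ p₀` holds with the geometric profile `q(i) = 72·C·L^{3m}·γ^s·(L³(L⁻¹)^s)^i`:
at height `j` of run `K = j + i` the large-field event is a union over `≤ 9·(2L^{m+i})³` plaquettes (`real_not_plaqSmall_comp_le_sum`,
`card_plaq_le_nine_mul`), each transported to the top of run `j` of `F.refine i` (§1, `θ_γ(i) = θ_{γL^{-i}}(0)`).
[cite: Balaban1985UV3, (1)-(3) p.256 and (7) p.257] -/
theorem averagedTailAt_of_polyTail {γ b₀ p₀ s C : ℝ} (hγ : 0 < γ) (hs : 3 < s) (hC : 0 ≤ C)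
    (h : ∀ (d K' : ℕ) (a' : Plaq ((F.refine d).P K') K'),
      (T3UnitScaleTilt.gibbsK (F.refine d) T3UnitLawDensityEML.ℰp (γ * ((F.L : ℝ)⁻¹) ^ d) K').real
          {V | T3UnitScaleTilt.θBal F.L (γ * ((F.L : ℝ)⁻¹) ^ d) b₀ p₀ 0 ≤ GaugeGroup.dist1 (GaugeField.plaqHol
            (Averaging.iter (fun i => BlockAveraging.blockAvg (P := (F.refine d).P K') (j := i) T3UnitLawDensityEML.ℰp) K' V) a')} ≤
        C * (γ * ((F.L : ℝ)⁻¹) ^ d) ^ s) :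
    AveragedTailAt F γ b₀ p₀ := by
  have hL1 : (1 : ℝ) < F.L := by exact_mod_cast F.hL.2
  have hL0 : (0 : ℝ) < F.L := one_pos.trans hL1
  obtain ⟨hr0, hr1⟩ := ratio_lt_one F hs
  set r : ℝ := (F.L : ℝ) ^ 3 * ((F.L : ℝ)⁻¹) ^ s with hrdef
  set A' : ℝ := 72 * C * (F.L : ℝ) ^ (3 * F.m) * γ ^ s with hA'def
  have hA'0 : 0 ≤ A' := by
    rw [hA'def]
    exact mul_nonneg (by positivity) (Real.rpow_nonneg hγ.le s)
  refine ⟨fun i => A' * r ^ i, fun i => mul_nonneg hA'0 (pow_nonneg hr0 i), ?_, ?_, fun K j hj1 hjK => ?_⟩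
  · exact (summable_geometric_of_lt_one hr0 hr1).mul_left A'
  · have heq : (fun n => ∑' t, A' * r ^ (t + n)) = fun n => (A' * (1 - r)⁻¹) * r ^ n := by
      funext n
      have h1 : (fun t => A' * r ^ (t + n)) = fun t => (A' * r ^ n) * r ^ t := by
        funext t; rw [pow_add]; ring
      rw [h1, tsum_mul_left, tsum_geometric_of_lt_one hr0 hr1]; ring
    rw [heq]
    exact (summable_geometric_of_lt_one hr0 hr1).mul_left (A' * (1 - r)⁻¹)
  -- the union bound over the plaquettes of height `j`, each transported to the top of `F.refine (K - j)`
  obtain ⟨i, rfl⟩ := Nat.exists_eq_add_of_le hjK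
  rw [Nat.add_sub_cancel_left]
  show _ ≤ A' * r ^ i
  haveI := isProbabilityMeasure_gibbsK F ℰp hγ.le (j + i)
  have hunion := real_not_plaqSmall_comp_le_sum (gibbsK F ℰp γ (j + i))
    (fun U => Averaging.iter (fun k => BlockAveraging.blockAvg (P := F.P (j + i)) (j := k) ℰp) j U) (θBal F.L γ b₀ p₀ i)
  refine hunion.trans ?_
  have hterm : ∀ a : Plaq (F.P (j + i)) j,
      (gibbsK F ℰp γ (j + i)).real {U | θBal F.L γ b₀ p₀ i ≤ GaugeGroup.dist1 (GaugeField.plaqHol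
        (Averaging.iter (fun k => BlockAveraging.blockAvg (P := F.P (j + i)) (j := k) ℰp) j U) a)} ≤
        C * (γ * ((F.L : ℝ)⁻¹) ^ i) ^ s := by
    intro a
    obtain ⟨a', ha'⟩ := real_plaqLarge_refine F hγ.le (θBal F.L γ b₀ p₀ i) i j a
    rw [ha', θBal_eq_θBal_refine_zero F.L γ b₀ p₀ i]
    exact h i j a'
  refine (Finset.sum_le_sum fun a _ => hterm a).trans ?_
  rw [Finset.sum_const, Finset.card_univ, nsmul_eq_mul]
  -- the number of plaquettes of height `j`: `≤ 9·(2·L^{m+i})³ = 72·L^{3m}·(L^i)³`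
  have hsites : ((F.P (j + i)).sitesPerDir j : ℝ) = 2 * (F.L : ℝ) ^ (F.m + i) := by
    rw [F.P_eq_PP, F.sitesPerDir_PP, show F.m + (j + i) - j = F.m + i by omega]; push_cast; ring
  have hcard : (Fintype.card (Plaq (F.P (j + i)) j) : ℝ) ≤ 72 * (F.L : ℝ) ^ (3 * F.m) * ((F.L : ℝ) ^ i) ^ 3 := by
    refine (card_plaq_le_nine_mul F (j + i) j).trans (le_of_eq ?_)
    rw [hsites]; ring
  have hnonneg : 0 ≤ C * (γ * ((F.L : ℝ)⁻¹) ^ i) ^ s :=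
    mul_nonneg hC (Real.rpow_nonneg (coupling_refine_pos_le F hγ i).1.le s)
  refine (mul_le_mul_of_nonneg_right hcard hnonneg).trans (le_of_eq ?_)
  rw [rpow_coupling_refine F hγ.le s i, hA'def, hrdef, mul_pow, ← pow_mul, ← pow_mul, mul_comm i 3]
  ring

end Averaged

/-! ## §3 S1_poly ⇒ `UnitScaleTilt.HistoryTailL` (19936) and ⇒ `HistoryWedge.WedgeTailL` (27959), by name -/

section Glue

/-- ★★★ **S1_poly ⇒ `UnitScaleTilt.HistoryTailL`** (crux stmt-QuantumFields-19936 of the parent route, BY NAME): a power-law unit-scale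
large-field tail `P_top ≤ C·γ^s`, ANY `s > 3`, uniform in the cut-off `K`, the volume exponent `m` and `γ ≤ γ₁`, at a profile chosen beyond the
prescribed thresholds, gives Bałaban's summably improbable UV-large-field histories at every free top fraction `m`: §2 along the refinement
orbit (admissible: `(F.refine d).L = L`, `0 < γL^{-d} ≤ γ ≤ γ₁`), then the tree's `historyTailAt_of_averagedTailAt` (the bare height is the
landed `bareTailAt`).  Conditional certificate: S1_poly is OPEN; no rung or summit is proved. [cite: Balaban1985UV3, (7) p.257 and (71) p.273] -/
theorem historyTailL_of_unitPolyTail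
    (hP : ∀ (L : ℕ) (b₁ p₁ : ℝ), ∃ (b₀ p₀ : ℝ), b₁ ≤ b₀ ∧ p₁ ≤ p₀ ∧ 0 < b₀ ∧ 2 < p₀ ∧
      ∃ (s C γ₁ : ℝ), 3 < s ∧ 0 ≤ C ∧ 0 < γ₁ ∧ γ₁ ≤ 1 ∧
        ∀ (F : T3Family) (γ : ℝ), F.L = L → 0 < γ → γ ≤ γ₁ → ∀ (K : ℕ) (a : Plaq (F.P K) K),
          (T3UnitScaleTilt.gibbsK F T3UnitLawDensityEML.ℰp γ K).real
              {U | T3UnitScaleTilt.θBal F.L γ b₀ p₀ 0 ≤ GaugeGroup.dist1 (GaugeField.plaqHol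
                (Averaging.iter (fun i => BlockAveraging.blockAvg (P := F.P K) (j := i) T3UnitLawDensityEML.ℰp) K U) a)} ≤
            C * γ ^ s) :
    Summit.QuantumFields.YangMills.Theses.UnitScaleTilt.HistoryTailL := by
  intro L b₁ p₁
  obtain ⟨b₀, p₀, hb₁, hp₁, hb₀, hp₀, s, C, γ₁, hs, hC, hγ₁, hγ₁1, hT⟩ := hP L b₁ p₁
  refine ⟨b₀, p₀, hb₁, hp₁, hb₀, hp₀, fun m hm => ⟨γ₁, hγ₁, fun F γ hFL hγ hγγ₁ => ?_⟩⟩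
  have hγ1 : γ ≤ 1 := hγγ₁.trans hγ₁1
  refine historyTailAt_of_averagedTailAt F hγ hγ1 hb₀ (by linarith) hm
    (averagedTailAt_of_polyTail F hγ hs hC fun d K' a' => ?_)
  obtain ⟨hγ', hγ'le⟩ := coupling_refine_pos_le F hγ d
  have key := hT (F.refine d) (γ * ((F.L : ℝ)⁻¹) ^ d) hFL hγ' (hγ'le.trans hγγ₁) K' a'
  exact key

/-- ★★ **S1_poly ⇒ `HistoryWedge.WedgeTailL`** (crux stmt-QuantumFields-27959, the organ's FLOOR currency, BY NAME): per `(F, γ)` the floor rate is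
`D = C·γ^s`, `ρ = (L⁻¹)^s` with `ρL³ = L^{3−s} < 1`; every height `1 ≤ j ≤ K` is served (the wedge guard `K ≤ m(K − j + 1)` is not used).
Conditional certificate; both sides stay OPEN. [cite: Balaban1985UV3, (7) p.257 and (71) p.273] -/
theorem wedgeTailL_of_unitPolyTail
    (hP : ∀ (L : ℕ) (b₁ p₁ : ℝ), ∃ (b₀ p₀ : ℝ), b₁ ≤ b₀ ∧ p₁ ≤ p₀ ∧ 0 < b₀ ∧ 2 < p₀ ∧
      ∃ (s C γ₁ : ℝ), 3 < s ∧ 0 ≤ C ∧ 0 < γ₁ ∧ γ₁ ≤ 1 ∧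
        ∀ (F : T3Family) (γ : ℝ), F.L = L → 0 < γ → γ ≤ γ₁ → ∀ (K : ℕ) (a : Plaq (F.P K) K),
          (T3UnitScaleTilt.gibbsK F T3UnitLawDensityEML.ℰp γ K).real
              {U | T3UnitScaleTilt.θBal F.L γ b₀ p₀ 0 ≤ GaugeGroup.dist1 (GaugeField.plaqHol
                (Averaging.iter (fun i => BlockAveraging.blockAvg (P := F.P K) (j := i) T3UnitLawDensityEML.ℰp) K U) a)} ≤
            C * γ ^ s) :
    Summit.QuantumFields.YangMills.Theses.HistoryWedge.WedgeTailL := by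
  intro L b₁ p₁
  obtain ⟨b₀, p₀, hb₁, hp₁, hb₀, hp₀, s, C, γ₁, hs, hC, hγ₁, hγ₁1, hT⟩ := hP L b₁ p₁
  refine ⟨b₀, p₀, hb₁, hp₁, hb₀, hp₀, fun m _hm => ⟨γ₁, hγ₁, hγ₁1, fun F γ hFL hγ hγγ₁ => ?_⟩⟩
  obtain ⟨hr0, hr1⟩ := ratio_lt_one F hs
  have hL0 : (0 : ℝ) ≤ ((F.L : ℝ)⁻¹) := inv_nonneg.mpr (Nat.cast_nonneg _)
  refine ⟨C * γ ^ s, ((F.L : ℝ)⁻¹) ^ s, mul_nonneg hC (Real.rpow_nonneg hγ.le s), Real.rpow_nonneg hL0 s, ?_,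
    fun K j _hj1 hjK _hw p => ?_⟩
  · subst hFL
    rw [mul_comm]
    exact hr1
  · obtain ⟨i, rfl⟩ := Nat.exists_eq_add_of_le hjK
    rw [Nat.add_sub_cancel_left]
    obtain ⟨a', ha'⟩ := real_plaqLarge_refine F hγ.le (θBal F.L γ b₀ p₀ i) i j p
    rw [ha', θBal_eq_θBal_refine_zero F.L γ b₀ p₀ i]
    obtain ⟨hγ', hγ'le⟩ := coupling_refine_pos_le F hγ i
    refine (hT (F.refine i) (γ * ((F.L : ℝ)⁻¹) ^ i) hFL hγ' (hγ'le.trans hγγ₁) j a').trans (le_of_eq ?_)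
    rw [rpow_coupling_refine F hγ.le s i, mul_assoc]

end Glue

/-! ## §4 The re-typed route's deciding theorem (kernel-checked; CONDITIONAL on three open hypotheses) -/

section Deciding

/-- ★ **THE RUNG-R3 LEAF FROM THE TWO RESIDUAL CRUXES AND S1_poly**: the parent route's kernel-checked `UnitScaleTilt.closes` (rev 14) fed with
`MinimiserStabilityRegPr` (stmt-QuantumFields-19200), `FluctuationComparisonRegPrIntL` (stmt-QuantumFields-20520) and, in place of its third binder
`HistoryTailL` (stmt-QuantumFields-19936), the power-law unit-scale tail S1_poly through §3.  This is the `closes` of the route re-typed as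
«25301 := S1_poly».  CONDITIONAL: all three hypotheses are OPEN; `YM3TorusSU2` is rung R3, a RECORD rung (existence and uniqueness of Bałaban's
ultraviolet limit on the 3-torus), NOT the Clay statement; the Yang–Mills mass gap is not touched.
[cite: Balaban1985UV3, (5) p.256 and (71) p.273; King1986, (3.12) p.657] -/
theorem ym3TorusSU2_of_residuals_and_unitPolyTail
    (h200 : Summit.QuantumFields.YangMills.Theses.UnitScaleTilt.MinimiserStabilityRegPr)
    (h201 : Summit.QuantumFields.YangMills.Theses.UnitScaleTilt.FluctuationComparisonRegPrIntL)
    (hP : ∀ (L : ℕ) (b₁ p₁ : ℝ), ∃ (b₀ p₀ : ℝ), b₁ ≤ b₀ ∧ p₁ ≤ p₀ ∧ 0 < b₀ ∧ 2 < p₀ ∧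
      ∃ (s C γ₁ : ℝ), 3 < s ∧ 0 ≤ C ∧ 0 < γ₁ ∧ γ₁ ≤ 1 ∧
        ∀ (F : T3Family) (γ : ℝ), F.L = L → 0 < γ → γ ≤ γ₁ → ∀ (K : ℕ) (a : Plaq (F.P K) K),
          (T3UnitScaleTilt.gibbsK F T3UnitLawDensityEML.ℰp γ K).real
              {U | T3UnitScaleTilt.θBal F.L γ b₀ p₀ 0 ≤ GaugeGroup.dist1 (GaugeField.plaqHol
                (Averaging.iter (fun i => BlockAveraging.blockAvg (P := F.P K) (j := i) T3UnitLawDensityEML.ℰp) K U) a)} ≤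
            C * γ ^ s) :
    Literature.MathematicalPhysics.QuantumFieldTheory.Balaban1983to89.T3YM3TorusStatement.YM3TorusSU2 :=
  Summit.QuantumFields.YangMills.Theses.UnitScaleTilt.closes h200 h201 (historyTailL_of_unitPolyTail hP)

end Deciding

end Summit.QuantumFields.YangMills.Theorems.CoarseStiffnessTailUnitPolyTail

end
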